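import Mathlib.Analysis.SpecialFunctions.Pow.Real
import Mathlib.Order.Filter.AtTopBot.Basic
import Mathlib.Topology.Algebra.Order.Field
import HarnessLib

/-!
# Philippon's criterion over Nesterenko's toolkit, V: consequences of the growth hypotheses — proofs only

`Literature/NumberTheory/Transcendental/PhilipponCriterionGrowth.lean` — proofs only (no new
definitions, nothing asserted). The named fact `Philippon1986_mainCriterion`
(`PhilipponCriterion.lean`; Philippon, Publ. Math. IHÉS 64 (1986), Thm 2.11) carries four
non-decreasing functions `σ, δ, R, S : ℕ → ℝ_{≥ 1}` with `τ = σ + δ → ∞`,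
`g = S/(τ δ^k)` non-decreasing and, for all `N`,

  `C τ(N+1) δ(N+1)^k (S(N)^{k+1} + R(N+1)^{k+1}) ≤ S(N)^{k+2}`        (G)

(the printed `S(N)^{k+2} ≥ C τ(N+1) δ(N+1)^k [S(N)^{k+1} + R(N+1)^{k+1}]`). This file extracts the
elementary consequences of (G) used throughout Philippon's §3 (pp. 42–48) and in the engine over
Nesterenko's invariants:

* `growth_S_ge_next` — `C τ(N+1) δ(N+1)^k ≤ S(N)` ("`S(N) ≥ C τ(N+1) δ(N+1)^k`", used on p. 46 in
  the form `S(M−1) ≥ C τ(M) δ(M)^k`);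
* `growth_S_ge` — `C τ(N) δ(N)^k ≤ S(N)`, i.e. `g(N) ≥ C` (`growth_C_le_g`);
* `growth_R_pow_le`, `growth_R_le` — `R(N+1)^{k+1} ≤ S(N)^{k+2}/(C τ(N+1) δ(N+1)^k)`, hence
  `R(N+1) ≤ S(N) · (g(N)/C)^{1/(k+1)}` (p. 45: "`S(M)/R(M+1) ≥ …`");
* `growth_tendsto_S` — `S → ∞`;
* monotonicity and positivity bookkeeping for `τ`, `τ δ^k`, `g`, `ξ = (g/C)^{1/(k+1)}`.

## References

* [Philippon1986Criteres] P. Philippon, Publ. Math. IHÉS 64 (1986), Thm 2.11 (p. 38) and §3.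
-/

noncomputable section

open Filter

namespace Literature.NumberTheory.Transcendental

namespace PhilipponMain

variable {σ δ R S : ℕ → ℝ} {C : ℝ} {k : ℕ}

/-! ### Positivity and monotonicity bookkeeping -/

/-- `τ = σ + δ ≥ 2 ≥ 1`. [folklore] -/
theorem one_le_tau (hσ1 : ∀ N, 1 ≤ σ N) (hδ1 : ∀ N, 1 ≤ δ N) (N : ℕ) : 1 ≤ σ N + δ N := by
  linarith [hσ1 N, hδ1 N]

/-- `τ δ^k ≥ 1`. [folklore] -/
theorem one_le_tau_mul_pow (hσ1 : ∀ N, 1 ≤ σ N) (hδ1 : ∀ N, 1 ≤ δ N) (N : ℕ) :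
    1 ≤ (σ N + δ N) * δ N ^ k :=
  one_le_mul_of_one_le_of_one_le (one_le_tau hσ1 hδ1 N) (one_le_pow₀ (hδ1 N))

/-- `τ δ^k` is non-decreasing. [folklore] -/
theorem monotone_tau_mul_pow (hσm : Monotone σ) (hδm : Monotone δ) (hσ1 : ∀ N, 1 ≤ σ N)
    (hδ1 : ∀ N, 1 ≤ δ N) : Monotone fun N => (σ N + δ N) * δ N ^ k := by
  intro M N hMN
  have hδ0 : 0 ≤ δ M := le_trans zero_le_one (hδ1 M)
  have hτN : 0 ≤ σ N + δ N := le_trans zero_le_one (one_le_tau hσ1 hδ1 N)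
  exact mul_le_mul (add_le_add (hσm hMN) (hδm hMN)) (pow_le_pow_left₀ hδ0 (hδm hMN) k)
    (pow_nonneg hδ0 k) hτN

/-! ### Consequences of the growth inequality (G) -/

section Growth

variable (hC : 0 < C) (hS1 : ∀ N, 1 ≤ S N) (hR0 : ∀ N, 0 ≤ R N)
  (hG : ∀ N, C * (σ (N + 1) + δ (N + 1)) * δ (N + 1) ^ k * (S N ^ (k + 1) + R (N + 1) ^ (k + 1))
    ≤ S N ^ (k + 2))

include hS1 hR0 hG in
/-- **`S(N) ≥ C τ(N+1) δ(N+1)^k`** (drop `R` in (G) and divide by `S(N)^{k+1}`).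
[cite: Philippon1986Criteres, Thm 2.11 and §3 p. 46] -/
theorem growth_S_ge_next (N : ℕ) : C * (σ (N + 1) + δ (N + 1)) * δ (N + 1) ^ k ≤ S N := by
  have hS : 0 < S N := lt_of_lt_of_le one_pos (hS1 N)
  have hpow : 0 < S N ^ (k + 1) := pow_pos hS _
  have hR : 0 ≤ R (N + 1) ^ (k + 1) := pow_nonneg (hR0 _) _
  by_cases hX : C * (σ (N + 1) + δ (N + 1)) * δ (N + 1) ^ k ≤ 0
  · exact hX.trans hS.le
  push Not at hX
  have h1 : C * (σ (N + 1) + δ (N + 1)) * δ (N + 1) ^ k * S N ^ (k + 1) ≤ S N * S N ^ (k + 1) := by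
    calc C * (σ (N + 1) + δ (N + 1)) * δ (N + 1) ^ k * S N ^ (k + 1)
        ≤ C * (σ (N + 1) + δ (N + 1)) * δ (N + 1) ^ k * (S N ^ (k + 1) + R (N + 1) ^ (k + 1)) :=
          mul_le_mul_of_nonneg_left (le_add_of_nonneg_right hR) hX.le
      _ ≤ S N ^ (k + 2) := hG N
      _ = S N * S N ^ (k + 1) := by ring
  exact le_of_mul_le_mul_right h1 hpow

include hS1 hR0 hG in
/-- **`R(N+1)^{k+1} · (C τ(N+1) δ(N+1)^k) ≤ S(N)^{k+2}`** (drop `S^{k+1}` in (G)).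
[cite: Philippon1986Criteres, Thm 2.11 and §3 p. 45] -/
theorem growth_R_pow_le (N : ℕ) :
    C * (σ (N + 1) + δ (N + 1)) * δ (N + 1) ^ k * R (N + 1) ^ (k + 1) ≤ S N ^ (k + 2) := by
  have hS : 0 < S N := lt_of_lt_of_le one_pos (hS1 N)
  by_cases hX : C * (σ (N + 1) + δ (N + 1)) * δ (N + 1) ^ k ≤ 0
  · exact (mul_nonpos_of_nonpos_of_nonneg hX (pow_nonneg (hR0 _) _)).trans (pow_nonneg hS.le _)
  push Not at hX
  calc C * (σ (N + 1) + δ (N + 1)) * δ (N + 1) ^ k * R (N + 1) ^ (k + 1)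
      ≤ C * (σ (N + 1) + δ (N + 1)) * δ (N + 1) ^ k * (S N ^ (k + 1) + R (N + 1) ^ (k + 1)) :=
        mul_le_mul_of_nonneg_left (le_add_of_nonneg_left (pow_nonneg hS.le _)) hX.le
    _ ≤ S N ^ (k + 2) := hG N

end Growth

section Monotone

variable (hC : 0 < C) (hσm : Monotone σ) (hδm : Monotone δ)
  (hσ1 : ∀ N, 1 ≤ σ N) (hδ1 : ∀ N, 1 ≤ δ N) (hS1 : ∀ N, 1 ≤ S N) (hR0 : ∀ N, 0 ≤ R N)
  (hG : ∀ N, C * (σ (N + 1) + δ (N + 1)) * δ (N + 1) ^ k * (S N ^ (k + 1) + R (N + 1) ^ (k + 1))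
    ≤ S N ^ (k + 2))

include hC hσm hδm hσ1 hδ1 hS1 hR0 hG in
/-- **`S(N) ≥ C τ(N) δ(N)^k`** (from `growth_S_ge_next` and monotonicity of `τ δ^k`).
[cite: Philippon1986Criteres, Thm 2.11] -/
theorem growth_S_ge (N : ℕ) : C * (σ N + δ N) * δ N ^ k ≤ S N := by
  have hmono := monotone_tau_mul_pow (k := k) hσm hδm hσ1 hδ1 (Nat.le_succ N)
  simp only at hmono
  calc C * (σ N + δ N) * δ N ^ k = C * ((σ N + δ N) * δ N ^ k) := by ring
    _ ≤ C * ((σ (N + 1) + δ (N + 1)) * δ (N + 1) ^ k) := mul_le_mul_of_nonneg_left hmono hC.le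
    _ = C * (σ (N + 1) + δ (N + 1)) * δ (N + 1) ^ k := by ring
    _ ≤ S N := growth_S_ge_next hS1 hR0 hG N

include hC hσm hδm hσ1 hδ1 hS1 hR0 hG in
/-- **`g(N) = S(N)/(τ(N) δ(N)^k) ≥ C`**. [cite: Philippon1986Criteres, Thm 2.11] -/
theorem growth_C_le_g (N : ℕ) : C ≤ S N / ((σ N + δ N) * δ N ^ k) := by
  have hpos : 0 < (σ N + δ N) * δ N ^ k := lt_of_lt_of_le one_pos (one_le_tau_mul_pow hσ1 hδ1 N)
  rw [le_div_iff₀ hpos]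
  calc C * ((σ N + δ N) * δ N ^ k) = C * (σ N + δ N) * δ N ^ k := by ring
    _ ≤ S N := growth_S_ge hC hσm hδm hσ1 hδ1 hS1 hR0 hG N

include hC hσm hδm hσ1 hδ1 hS1 hR0 hG in
/-- `S(N) ≥ C τ(N)`; in particular `S(N) ≥ C`. [folklore] -/
theorem growth_C_mul_tau_le_S (N : ℕ) : C * (σ N + δ N) ≤ S N := by
  have h1 : C * (σ N + δ N) ≤ C * (σ N + δ N) * δ N ^ k := by
    have : 1 ≤ δ N ^ k := one_le_pow₀ (hδ1 N)
    have h0 : 0 ≤ C * (σ N + δ N) := mul_nonneg hC.le (le_trans zero_le_one (one_le_tau hσ1 hδ1 N))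
    nlinarith
  exact h1.trans (growth_S_ge hC hσm hδm hσ1 hδ1 hS1 hR0 hG N)

include hC hσm hδm hσ1 hδ1 hS1 hR0 hG in
/-- **`S → ∞`** (since `S ≥ C τ` and `τ → ∞`). [cite: Philippon1986Criteres, Thm 2.11] -/
theorem growth_tendsto_S (htend : Tendsto (fun N => σ N + δ N) atTop atTop) :
    Tendsto S atTop atTop := by
  have h1 : Tendsto (fun N => C * (σ N + δ N)) atTop atTop := Tendsto.const_mul_atTop hC htend
  exact tendsto_atTop_mono (growth_C_mul_tau_le_S hC hσm hδm hσ1 hδ1 hS1 hR0 hG) h1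

include hC hσm hδm hσ1 hδ1 hS1 hR0 hG in
/-- **`R(N+1) ≤ S(N) · (g(N)/C)^{1/(k+1)}`**, `g = S/(τδ^k)`: from `growth_R_pow_le` and
`τ(N+1) δ(N+1)^k ≥ τ(N) δ(N)^k`, `R(N+1)^{k+1} ≤ S(N)^{k+1} · (g(N)/C)`, and `(k+1)`-st roots.
[cite: Philippon1986Criteres, §3 p. 45] -/
theorem growth_R_le (N : ℕ) :
    R (N + 1) ≤ S N * (S N / ((σ N + δ N) * δ N ^ k) / C) ^ ((1 : ℝ) / (k + 1)) := by
  have hS : 0 < S N := lt_of_lt_of_le one_pos (hS1 N)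
  have hτδ : 0 < (σ N + δ N) * δ N ^ k := lt_of_lt_of_le one_pos (one_le_tau_mul_pow hσ1 hδ1 N)
  have hτδ' : 0 < (σ (N + 1) + δ (N + 1)) * δ (N + 1) ^ k :=
    lt_of_lt_of_le one_pos (one_le_tau_mul_pow hσ1 hδ1 (N + 1))
  set q : ℝ := S N / ((σ N + δ N) * δ N ^ k) / C with hq
  have hq0 : 0 ≤ q := div_nonneg (div_nonneg hS.le hτδ.le) hC.le
  -- `R'^{k+1} ≤ S^{k+1} q`
  have hmono := monotone_tau_mul_pow (k := k) hσm hδm hσ1 hδ1 (Nat.le_succ N)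
  simp only at hmono
  have h1 : R (N + 1) ^ (k + 1) ≤ S N ^ (k + 1) * q := by
    have h := growth_R_pow_le hS1 hR0 hG N
    -- divide by `C τ' δ'^k ≥ C τ δ^k > 0`
    have hden : 0 < C * (σ (N + 1) + δ (N + 1)) * δ (N + 1) ^ k := by
      rw [mul_assoc]; exact mul_pos hC hτδ'
    have h2 : R (N + 1) ^ (k + 1) ≤ S N ^ (k + 2) / (C * (σ (N + 1) + δ (N + 1)) * δ (N + 1) ^ k) := by
      rw [le_div_iff₀ hden]; linarith
    have h3 : S N ^ (k + 2) / (C * (σ (N + 1) + δ (N + 1)) * δ (N + 1) ^ k) ≤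
        S N ^ (k + 2) / (C * ((σ N + δ N) * δ N ^ k)) := by
      apply div_le_div_of_nonneg_left (pow_nonneg hS.le _) (mul_pos hC hτδ)
      calc C * ((σ N + δ N) * δ N ^ k) ≤ C * ((σ (N + 1) + δ (N + 1)) * δ (N + 1) ^ k) :=
            mul_le_mul_of_nonneg_left hmono hC.le
        _ = C * (σ (N + 1) + δ (N + 1)) * δ (N + 1) ^ k := by ring
    have h4 : S N ^ (k + 2) / (C * ((σ N + δ N) * δ N ^ k)) = S N ^ (k + 1) * q := by
      rw [hq]
      field_simp
      ring
    linarith [h2.trans h3]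
  -- `(S q^{1/(k+1)})^{k+1} = S^{k+1} q`
  have hk1 : ((k : ℝ) + 1) ≠ 0 := by positivity
  have h5 : (S N * q ^ ((1 : ℝ) / (k + 1))) ^ (k + 1) = S N ^ (k + 1) * q := by
    rw [mul_pow, ← Real.rpow_natCast (q ^ ((1 : ℝ) / (k + 1))) (k + 1), ← Real.rpow_mul hq0]
    have : (1 : ℝ) / (k + 1) * ((k + 1 : ℕ) : ℝ) = 1 := by push_cast; field_simp
    rw [this, Real.rpow_one]
  have h6 : R (N + 1) ^ (k + 1) ≤ (S N * q ^ ((1 : ℝ) / (k + 1))) ^ (k + 1) := by rw [h5]; exact h1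
  exact le_of_pow_le_pow_left₀ (Nat.succ_ne_zero k) (mul_nonneg hS.le (Real.rpow_nonneg hq0 _)) h6

include hC hσm hδm hσ1 hδ1 hS1 hR0 hG in
/-- `ξ(N) = (g(N)/C)^{1/(k+1)} ≥ 1`. [folklore] -/
theorem growth_one_le_xi (N : ℕ) : 1 ≤ (S N / ((σ N + δ N) * δ N ^ k) / C) ^ ((1 : ℝ) / (k + 1)) := by
  refine Real.one_le_rpow ?_ (by positivity)
  rw [le_div_iff₀ hC, one_mul]
  exact growth_C_le_g hC hσm hδm hσ1 hδ1 hS1 hR0 hG N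

/-- `ξ = (g/C)^{1/(k+1)}` is non-decreasing when `g` is (the hypothesis "`S/(τδ^k)` non-decreasing"
of Thm 2.11; used on p. 45 to compare the levels `M < N`). [cite: Philippon1986Criteres, §3 p. 45] -/
theorem growth_monotone_xi (hC : 0 < C)
    (hmono : Monotone fun N => S N / ((σ N + δ N) * δ N ^ k))
    (hg0 : ∀ N, 0 ≤ S N / ((σ N + δ N) * δ N ^ k)) :
    Monotone fun N => (S N / ((σ N + δ N) * δ N ^ k) / C) ^ ((1 : ℝ) / (k + 1)) := by
  intro M N hMN
  exact Real.rpow_le_rpow (div_nonneg (hg0 M) hC.le) (div_le_div_of_nonneg_right (hmono hMN) hC.le)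
    (by positivity)

end Monotone

end PhilipponMain

end Literature.NumberTheory.Transcendental

end
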